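import Summits.ValiantsHypothesis.ValiantsHypothesis.Theses.FermionicJet

/-!
# FermionicJet — Assembly

Route `ValiantsHypothesis/FermionicJet`, item `stmt-ValiantsHypothesis-5350` (rank 1, assembly):
`BoundedOrderHardness → JetsInVNP → ValiantsHypothesis`.

Pure bookkeeping.  `BoundedOrderHardness` supplies a jet order `k` whose jet family
`f_{·,k} = Σ_σ sgn(σ)·C(c(σ),k)·x^σ` is not a VP family over `ℂ`; `JetsInVNP` says every jet
family is a VNP family over `ℂ`.  If `VP ℂ = VNP ℂ`, the bundled order-`k` jet family lies in
`VNP ℂ` (`mem_VNP_ofFintype_iff_holds`), hence in `VP ℂ`, hence is a VP family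
(`mem_VP_ofFintype_iff_holds`) — contradiction.  No named-fact hypothesis is used: both cone
facts are discharged in `Literature.Computability.AlgebraicComplexity.ValiantClasses`.
-/

-- `Summit.ValiantsHypothesis.ValiantsHypothesis.…` is the tree's mandated single-conjunct layout
-- (Sub = Summit), so the duplicated namespace component is intended.
set_option linter.dupNamespace false

namespace Summit.ValiantsHypothesis.ValiantsHypothesis.Theorems.FermionicJet

open Summit.ValiantsHypothesis.ValiantsHypothesis.Theses.FermionicJet

/-- **Assembly** (route FermionicJet, item stmt-ValiantsHypothesis-5350): bounded-order hardness
of the fermionic pencil at the free-fermion point, together with VNP-membership of every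
fixed-order jet family, gives Valiant's hypothesis `VP ℂ ≠ VNP ℂ`.  From `VP ℂ = VNP ℂ` the
hard jet family of order `k` would be bundled into `VNP ℂ = VP ℂ` and unbundled back into a
VP family (Bürgisser 2000, Rem. 2.2: bundling along `Fintype.equivFin` is harmless). -/
theorem assembly_proof :
    Summit.ValiantsHypothesis.ValiantsHypothesis.Theses.FermionicJet.Assembly := by
  unfold Assembly BoundedOrderHardness JetsInVNP
  intro hX hVNP
  show Literature.Computability.AlgebraicComplexity.VP ℂ ≠
    Literature.Computability.AlgebraicComplexity.VNP ℂ
  intro hEq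
  obtain ⟨m, hm⟩ := hX
  apply hm
  have hmem :=
    (Literature.Computability.AlgebraicComplexity.mem_VNP_ofFintype_iff_holds _).2 (hVNP m)
  rw [← hEq] at hmem
  exact (Literature.Computability.AlgebraicComplexity.mem_VP_ofFintype_iff_holds _).1 hmem

end Summit.ValiantsHypothesis.ValiantsHypothesis.Theorems.FermionicJet
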